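import Summits.Langlands.Langlands.Theses.PhantomRMYoshida
import Summits.Langlands.Langlands.Theorems.PhantomRMYoshidaPhantomRMJunction
import Summits.Langlands.Langlands.Theorems.PhantomRMYoshidaSectorGlue
import Summits.Langlands.Langlands.Theorems.PhantomRMYoshidaAssembly
import Summits.Langlands.Langlands.Theorems.PhantomRMYoshidaYoshidaResidualSp4Schur
import Summits.Langlands.Langlands.Theorems.PhantomRMYoshidaPhantomRMTransport

/-!
# EquivAudit — crux-strategist q1 (suspect = equivalence) on `PhantomRMJunction` (stmt-Langlands-13643)

Kernel-checked bookkeeping for the question "does the landed witness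
`phantomRMJunction_iff_of_target : PhantomRMSector → (PhantomRMJunction ↔ Langlands)` collapse the
item onto the summit FOR FREE, i.e. is its conditioning sibling insubstantial / already proved?"

* § 1 `iff_unconditional_iff` : `(J ↔ S) ↔ (X ∨ S)` — the UNCONDITIONAL equivalence is exactly
  "route target OR summit"; it is free only if the (open) target `PhantomRMSector` is proved.
* § 2 `witness_condition_of_cruxes` : the witness's hypothesis X follows from the three OPEN cruxes
  through the PROVED pure-logic glue `sectorGlue_proof` — the proved glue transports the condition, it
  does not discharge it.
* § 3 `proved_siblings` / `collapse_given_proved_siblings_iff` : the four PROVED siblings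
  (SectorGlue, Assembly, PhantomRMTransport, YoshidaResidualSp4Schur) are closed theorems, hence
  "the equivalence collapses given the proved siblings" is LITERALLY `X ∨ S` again — no proved sibling
  enters the equivalence.
* § 4 the two glue items are λ-terms over `closes` (insubstantial BY DESIGN, kinded support/assembly);
  `#print axioms` of all four proved siblings and of `closes` (no `sorryAx`).
-/

namespace EquivAudit

open Summit.Langlands.Langlands.Theses.PhantomRMYoshida
open Summit.Langlands.Langlands.Theorems

/-! ## § 1 — the witness is conditional; unconditionally `(J ↔ S) ↔ (X ∨ S)` -/

theorem iff_unconditional_iff :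
    (PhantomRMJunction ↔ _root_.Langlands) ↔ (PhantomRMSector ∨ _root_.Langlands) := by
  constructor
  · intro h
    by_cases hS : _root_.Langlands
    · exact Or.inr hS
    · have hJ : ¬ PhantomRMJunction := fun hJ => hS (h.mp hJ)
      exact Or.inl (not_phantomRMJunction_iff.mp hJ).1
  · rintro (hX | hS)
    · exact phantomRMJunction_iff_of_target hX
    · exact ⟨fun _ => hS, fun h _ => h⟩

/-- The converse direction of the witness is free (`S → J`), so the content of the `↔` is `J → S`,
and `(J → S) ↔ (X ∨ S)`. -/
theorem imp_summit_iff : (PhantomRMJunction → _root_.Langlands) ↔ (PhantomRMSector ∨ _root_.Langlands) := by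
  rw [← iff_unconditional_iff]
  exact ⟨fun h => ⟨h, fun hS _ => hS⟩, fun h => h.mp⟩

/-! ## § 2 — the condition X is carried by the three OPEN cruxes through the PROVED glue -/

theorem witness_condition_of_cruxes (hKW : SerreKWAutomorphicGL2) (hS : StableYoshidaCongruence)
    (hL : ResiduallyYoshidaLifting) : PhantomRMSector :=
  PhantomRMYoshida.sectorGlue_proof hKW hS hL

/-- hence the `_of_cruxes` form of the witness is the `_of_target` form precomposed with the glue. -/
theorem witness_of_cruxes_eq (hKW : SerreKWAutomorphicGL2) (hS : StableYoshidaCongruence)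
    (hL : ResiduallyYoshidaLifting) : (PhantomRMJunction ↔ _root_.Langlands) :=
  phantomRMJunction_iff_of_target (witness_condition_of_cruxes hKW hS hL)

/-! ## § 3 — the PROVED siblings do not enter the equivalence -/

/-- The four proved siblings of the route, as one closed term. -/
theorem proved_siblings :
    SectorGlue ∧ Assembly ∧ PhantomRMTransport ∧ YoshidaResidualSp4Schur :=
  ⟨PhantomRMYoshida.sectorGlue_proof, PhantomRMYoshida.Assembly_proof, phantomRMTransport_proof,
    PhantomRMYoshida.yoshidaResidualSp4Schur_proof⟩

/-- "Given every PROVED sibling, `J ↔ S`" is literally `X ∨ S`: the proved siblings are theorems, so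
hypothesising them adds nothing, and what is left is § 1. In particular the equivalence does NOT
collapse for free: it collapses iff the open target (or the summit) is proved. -/
theorem collapse_given_proved_siblings_iff :
    (SectorGlue → Assembly → PhantomRMTransport → YoshidaResidualSp4Schur →
        (PhantomRMJunction ↔ _root_.Langlands)) ↔ (PhantomRMSector ∨ _root_.Langlands) := by
  rw [← iff_unconditional_iff]
  exact ⟨fun h => h proved_siblings.1 proved_siblings.2.1 proved_siblings.2.2.1 proved_siblings.2.2.2,
    fun h _ _ _ _ => h⟩

/-! ## § 4 — the glue items are pure logic by design; axioms of the proved siblings -/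

/-- `SectorGlue` is the inner λ-term of `closes`. -/
example : SectorGlue := fun hKW hS hL => PhantomRMYoshida.phantomRMSector_of_cruxes hKW hS hL

/-- `Assembly` is `closes` curried. -/
example : Assembly := fun hKW hS hL hJ => closes hKW hS hL hJ

/-- and `closes` factors as junction ∘ glue: the junction is the LAST hypothesis, applied to the
glue's output — the signature of a complete decomposition, whatever the size of the pieces. -/
example (hKW : SerreKWAutomorphicGL2) (hS : StableYoshidaCongruence) (hL : ResiduallyYoshidaLifting)
    (hJ : PhantomRMJunction) : _root_.Langlands :=
  hJ (PhantomRMYoshida.phantomRMSector_of_cruxes hKW hS hL)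

#print axioms Summit.Langlands.Langlands.Theorems.PhantomRMYoshida.sectorGlue_proof
#print axioms Summit.Langlands.Langlands.Theorems.PhantomRMYoshida.Assembly_proof
#print axioms Summit.Langlands.Langlands.Theorems.phantomRMTransport_proof
#print axioms Summit.Langlands.Langlands.Theorems.PhantomRMYoshida.yoshidaResidualSp4Schur_proof
#print axioms Summit.Langlands.Langlands.Theses.PhantomRMYoshida.closes
#print axioms EquivAudit.collapse_given_proved_siblings_iff

end EquivAudit
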